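import Mathlib
import Summits.KontsevichZagierPeriods.Zeta5Search.RhinViolaThetaComplex
import Summits.KontsevichZagierPeriods.Zeta5Search.RhinViolaGeneratorsComplex
import Summits.KontsevichZagierPeriods.Zeta5Search.RhinViolaIntegrable
import Summits.KontsevichZagierPeriods.Zeta5Search.RhinViolaWordHprime
import HarnessLib

/-!
# ζ(5) search — Brown–Zudilin's `h'` and `h` as `ϑ`-CONJUGATES of one (resp. two) Euler steps: the side condition `p₀ ≤ p₁+q₁` removed (cell `pub-zeta5`, seat ct-1 g13)

HONEST FRAMING: systematic search; no irrationality claim unless kernel-certified. Nothing in this file is an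
irrationality result, a worthiness exponent or a denominator statement. `RhinViolaWordHprime.rv_word_hprime` realises
Brown–Zudilin's `h'`-step [BrownZudilin2022, Sect. 7] on the Rhin–Viola triple integral by the word `φϑφσφχ`, whose two
hypergeometric moves on the `p₀`-link need `0 ≤ p₀ ≤ p₁+q₁`. A search through Rhin–Viola's group `Φ` (|Φ| = 1920;
`ct-1/g13/code/word_search*.py`) finds words realising the SAME elements with fewer hypergeometric letters and NO condition
on `p₀`:

* `h'` = `σ ϑ ϑ σ φ ϑ ϑ` — a single Euler step `φ` (link exponent `p₂+q₂−p₁+1 ↦ p₂+1`) conjugated by changes of variables;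
* `h`  = `σ φ ϑ ϑ ϑ ϑ φ ϑ ϑ ϑ` — two Euler steps (links `p₀+1 ↦ p₂+1` and `q₁+q₂−p₀+1 ↦ Q+p₁−p₀+1`).

Since `ϑ` (`RhinViolaThetaComplex.rv_theta_invariance_cpow`) and `σ` are unconditional identities of Bochner integrals, the
only hypotheses left are the 1-D Beta conditions of the Euler steps and the absolute convergence of the integrals adjacent to
them — all of which are consequences of the convergence forms (3) of `a` and `h'a` (resp. `ha`), see `JintegralHprime.lean`,
`JintegralH.lean`. **`rv_conj_hprime`** (any INTEGER `p₀`), **`rv_conj_h`** (`p₀ ≤ p₂+q₂`, `p₀ ≤ q₁+q₂`, no `p₀ ≤ p₁+q₁`).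
[Rhin–Viola, Acta Arith. 97 (2001), §§2–4; BrownZudilin2022, Sect. 7] Theorems only (no new definitions).
-/

noncomputable section

namespace Summit.KontsevichZagierPeriods.Zeta5Search.RhinViolaConjugation

open MeasureTheory Set Filter
open Summit.KontsevichZagierPeriods.Zeta5Search.RhinViolaThetaComplex (rv_theta_invariance_cpow rv_sigma_cpow)
open Summit.KontsevichZagierPeriods.Zeta5Search.RhinViolaGeneratorsComplex (rv_phi_cpow)
open Summit.KontsevichZagierPeriods.Zeta5Search.RhinViolaIntegrable (rv_integrableOn_cpow)
open Summit.KontsevichZagierPeriods.Zeta5Search.RhinViolaWordHprime (rv_pt_congr rv_T_congr)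

/-- **Brown–Zudilin's `h'`-step as a conjugate of ONE Euler step** (`h' = σϑϑσ·φ·ϑϑ` in Rhin–Viola's generators): for an
INTEGER `p₀`, naturals `p₁ ≤ p₂+q₂`, `q₁`, `q₂`, and complex `j` with `−1 < Re j < min(q₁+q₂+1, p₁+q₁+1)`,
`p₀ + Re j < min(p₁,p₂)+q₁+q₂+1`:
`Γ(p₂+q₂−p₁+1)Γ(p₁+q₁−j+1)·T(p₁,q₁,p₂,q₂; j, q₁+q₂−j; p₀+1) = Γ(p₂+1)Γ(q₁+q₂−j+1)·T(q₂,q₁,p₂+q₂−p₁,p₁; j, p₁+q₁−j; p₀+1)`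
— the conclusion of `RhinViolaWordHprime.rv_word_hprime` WITHOUT `0 ≤ p₀ ≤ p₁+q₁`. [BrownZudilin2022, Sect. 7 (`h'`); RV §4] -/
theorem rv_conj_hprime (p0 : ℤ) (p1 q1 p2 q2 : ℕ) (hk : p1 ≤ p2 + q2) (j : ℂ) (hj : -1 < j.re)
    (hjQ : j.re < q1 + q2 + 1) (hjc : j.re < p1 + q1 + 1) (hA : (p0 : ℝ) + j.re < p1 + q1 + q2 + 1)
    (hB : (p0 : ℝ) + j.re < p2 + q1 + q2 + 1) :
    Complex.Gamma ((p2 : ℂ) + q2 - p1 + 1) * Complex.Gamma ((p1 : ℂ) + q1 - j + 1) *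
        (∫ x in (univ.pi fun _ : Fin 3 => Ioo (0:ℝ) 1), ((x 0 : ℝ) : ℂ) ^ (p1 : ℂ) * ((1 - x 0 : ℝ) : ℂ) ^ (q1 : ℂ) *
          ((x 1 : ℝ) : ℂ) ^ (p2 : ℂ) * ((1 - x 1 : ℝ) : ℂ) ^ (q2 : ℂ) * ((x 2 : ℝ) : ℂ) ^ j *
          ((1 - x 2 : ℝ) : ℂ) ^ ((q1 : ℂ) + q2 - j) / ((1 - (1 - x 0 * x 1) * x 2 : ℝ) : ℂ) ^ ((p0 : ℂ) + 1)) =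
      Complex.Gamma ((p2 : ℂ) + 1) * Complex.Gamma ((q1 : ℂ) + q2 - j + 1) *
        (∫ x in (univ.pi fun _ : Fin 3 => Ioo (0:ℝ) 1), ((x 0 : ℝ) : ℂ) ^ (q2 : ℂ) * ((1 - x 0 : ℝ) : ℂ) ^ (q1 : ℂ) *
          ((x 1 : ℝ) : ℂ) ^ ((p2 : ℂ) + q2 - p1) * ((1 - x 1 : ℝ) : ℂ) ^ (p1 : ℂ) * ((x 2 : ℝ) : ℂ) ^ j *
          ((1 - x 2 : ℝ) : ℂ) ^ ((p1 : ℂ) + q1 - j) / ((1 - (1 - x 0 * x 1) * x 2 : ℝ) : ℂ) ^ ((p0 : ℂ) + 1)) := by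
  have hk' : (p1 : ℝ) ≤ p2 + q2 := by exact_mod_cast hk
  have n1 := p1.cast_nonneg (α := ℝ); have m1 := q1.cast_nonneg (α := ℝ)
  have n2 := p2.cast_nonneg (α := ℝ); have m2 := q2.cast_nonneg (α := ℝ)
  -- absolute convergence of the two integrals around the single Euler step `φ`
  have I4 := rv_integrableOn_cpow ((p2 : ℂ)) ((q1 : ℂ) + q2 - j) ((q1 : ℂ) + q2 - j + p2 - p0) (j) ((q1 : ℂ)) ((q2 : ℂ)) ((p2 : ℂ) + q2 - p1 + 1)
    (by simp; linarith) (by simp; linarith) (by simp; linarith) hj (by simp; linarith)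
    (by simp; linarith) (by simp; linarith) (by simp; linarith)
  have I5 := rv_integrableOn_cpow ((p2 : ℂ) + q2 - p1) ((q1 : ℂ) + p1 - j) ((q1 : ℂ) + q2 - j + p2 - p0) (j) ((q1 : ℂ)) ((p1 : ℂ)) ((p2 : ℂ) + 1)
    (by simp; linarith) (by simp; linarith) (by simp; linarith) hj (by simp; linarith)
    (by simp; linarith) (by simp; linarith) (by simp; linarith)
  -- σ, ϑ, ϑ, σ : changes of variables only (no side condition)
  have S1 : (∫ x in (univ.pi fun _ : Fin 3 => Ioo (0:ℝ) 1), ((x 0 : ℝ) : ℂ) ^ (p1 : ℂ) * ((1 - x 0 : ℝ) : ℂ) ^ (q1 : ℂ) *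
          ((x 1 : ℝ) : ℂ) ^ (p2 : ℂ) * ((1 - x 1 : ℝ) : ℂ) ^ (q2 : ℂ) * ((x 2 : ℝ) : ℂ) ^ j *
          ((1 - x 2 : ℝ) : ℂ) ^ ((q1 : ℂ) + q2 - j) / ((1 - (1 - x 0 * x 1) * x 2 : ℝ) : ℂ) ^ ((p0 : ℂ) + 1)) =
      (∫ x in (univ.pi fun _ : Fin 3 => Ioo (0:ℝ) 1), ((x 0 : ℝ) : ℂ) ^ (p2 : ℂ) * ((1 - x 0 : ℝ) : ℂ) ^ (q2 : ℂ) *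
          ((x 1 : ℝ) : ℂ) ^ (p1 : ℂ) * ((1 - x 1 : ℝ) : ℂ) ^ (q1 : ℂ) * ((x 2 : ℝ) : ℂ) ^ j *
          ((1 - x 2 : ℝ) : ℂ) ^ ((q1 : ℂ) + q2 - j) / ((1 - (1 - x 0 * x 1) * x 2 : ℝ) : ℂ) ^ ((p0 : ℂ) + 1)) :=
    rv_sigma_cpow _ _ _ _ _ _ _
  have S2 : (∫ x in (univ.pi fun _ : Fin 3 => Ioo (0:ℝ) 1), ((x 0 : ℝ) : ℂ) ^ (p2 : ℂ) * ((1 - x 0 : ℝ) : ℂ) ^ (q2 : ℂ) *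
          ((x 1 : ℝ) : ℂ) ^ (p1 : ℂ) * ((1 - x 1 : ℝ) : ℂ) ^ (q1 : ℂ) * ((x 2 : ℝ) : ℂ) ^ j *
          ((1 - x 2 : ℝ) : ℂ) ^ ((q1 : ℂ) + q2 - j) / ((1 - (1 - x 0 * x 1) * x 2 : ℝ) : ℂ) ^ ((p0 : ℂ) + 1)) =
      (∫ x in (univ.pi fun _ : Fin 3 => Ioo (0:ℝ) 1), ((x 0 : ℝ) : ℂ) ^ (q1 : ℂ) * ((1 - x 0 : ℝ) : ℂ) ^ (p1 : ℂ) *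
          ((x 1 : ℝ) : ℂ) ^ j * ((1 - x 1 : ℝ) : ℂ) ^ ((q1 : ℂ) + q2 - j + p2 - p0) * ((x 2 : ℝ) : ℂ) ^ (p2 : ℂ) *
          ((1 - x 2 : ℝ) : ℂ) ^ ((q1 : ℂ) + q2 - j + p1 - p0) / ((1 - (1 - x 0 * x 1) * x 2 : ℝ) : ℂ) ^ ((p1 : ℂ) + q1 - p0 + 1)) :=
    (rv_theta_invariance_cpow ((p2 : ℂ)) ((q2 : ℂ)) ((p1 : ℂ)) ((q1 : ℂ)) (j) ((q1 : ℂ) + q2 - j) ((p0 : ℂ) + 1) (by ring)).trans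
      (rv_T_congr (by ring) (by ring) (by ring) (by ring) (by ring) (by ring) (by ring))
  have S3 : (∫ x in (univ.pi fun _ : Fin 3 => Ioo (0:ℝ) 1), ((x 0 : ℝ) : ℂ) ^ (q1 : ℂ) * ((1 - x 0 : ℝ) : ℂ) ^ (p1 : ℂ) *
          ((x 1 : ℝ) : ℂ) ^ j * ((1 - x 1 : ℝ) : ℂ) ^ ((q1 : ℂ) + q2 - j + p2 - p0) * ((x 2 : ℝ) : ℂ) ^ (p2 : ℂ) *
          ((1 - x 2 : ℝ) : ℂ) ^ ((q1 : ℂ) + q2 - j + p1 - p0) / ((1 - (1 - x 0 * x 1) * x 2 : ℝ) : ℂ) ^ ((p1 : ℂ) + q1 - p0 + 1)) =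
      (∫ x in (univ.pi fun _ : Fin 3 => Ioo (0:ℝ) 1), ((x 0 : ℝ) : ℂ) ^ ((q1 : ℂ) + q2 - j + p2 - p0) * ((1 - x 0 : ℝ) : ℂ) ^ j *
          ((x 1 : ℝ) : ℂ) ^ (p2 : ℂ) * ((1 - x 1 : ℝ) : ℂ) ^ ((q1 : ℂ) + q2 - j) * ((x 2 : ℝ) : ℂ) ^ (q1 : ℂ) *
          ((1 - x 2 : ℝ) : ℂ) ^ (q2 : ℂ) / ((1 - (1 - x 0 * x 1) * x 2 : ℝ) : ℂ) ^ ((p2 : ℂ) + q2 - p1 + 1)) :=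
    (rv_theta_invariance_cpow ((q1 : ℂ)) ((p1 : ℂ)) (j) ((q1 : ℂ) + q2 - j + p2 - p0) ((p2 : ℂ)) ((q1 : ℂ) + q2 - j + p1 - p0) ((p1 : ℂ) + q1 - p0 + 1) (by ring)).trans
      (rv_T_congr (by ring) (by ring) (by ring) (by ring) (by ring) (by ring) (by ring))
  have S4 : (∫ x in (univ.pi fun _ : Fin 3 => Ioo (0:ℝ) 1), ((x 0 : ℝ) : ℂ) ^ ((q1 : ℂ) + q2 - j + p2 - p0) * ((1 - x 0 : ℝ) : ℂ) ^ j *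
          ((x 1 : ℝ) : ℂ) ^ (p2 : ℂ) * ((1 - x 1 : ℝ) : ℂ) ^ ((q1 : ℂ) + q2 - j) * ((x 2 : ℝ) : ℂ) ^ (q1 : ℂ) *
          ((1 - x 2 : ℝ) : ℂ) ^ (q2 : ℂ) / ((1 - (1 - x 0 * x 1) * x 2 : ℝ) : ℂ) ^ ((p2 : ℂ) + q2 - p1 + 1)) =
      (∫ x in (univ.pi fun _ : Fin 3 => Ioo (0:ℝ) 1), ((x 0 : ℝ) : ℂ) ^ (p2 : ℂ) * ((1 - x 0 : ℝ) : ℂ) ^ ((q1 : ℂ) + q2 - j) *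
          ((x 1 : ℝ) : ℂ) ^ ((q1 : ℂ) + q2 - j + p2 - p0) * ((1 - x 1 : ℝ) : ℂ) ^ j * ((x 2 : ℝ) : ℂ) ^ (q1 : ℂ) *
          ((1 - x 2 : ℝ) : ℂ) ^ (q2 : ℂ) / ((1 - (1 - x 0 * x 1) * x 2 : ℝ) : ℂ) ^ ((p2 : ℂ) + q2 - p1 + 1)) :=
    rv_sigma_cpow _ _ _ _ _ _ _
  -- φ in `x` (link exponent `p₂+q₂−p₁+1 ↦ p₂+1`)
  have S5 : Complex.Gamma ((p2 : ℂ) + q2 - p1 + 1) * Complex.Gamma ((p1 : ℂ) + q1 - j + 1) *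
      (∫ x in (univ.pi fun _ : Fin 3 => Ioo (0:ℝ) 1), ((x 0 : ℝ) : ℂ) ^ (p2 : ℂ) * ((1 - x 0 : ℝ) : ℂ) ^ ((q1 : ℂ) + q2 - j) *
          ((x 1 : ℝ) : ℂ) ^ ((q1 : ℂ) + q2 - j + p2 - p0) * ((1 - x 1 : ℝ) : ℂ) ^ j * ((x 2 : ℝ) : ℂ) ^ (q1 : ℂ) *
          ((1 - x 2 : ℝ) : ℂ) ^ (q2 : ℂ) / ((1 - (1 - x 0 * x 1) * x 2 : ℝ) : ℂ) ^ ((p2 : ℂ) + q2 - p1 + 1)) =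
      Complex.Gamma ((p2 : ℂ) + 1) * Complex.Gamma ((q1 : ℂ) + q2 - j + 1) *
      (∫ x in (univ.pi fun _ : Fin 3 => Ioo (0:ℝ) 1), ((x 0 : ℝ) : ℂ) ^ ((p2 : ℂ) + q2 - p1) * ((1 - x 0 : ℝ) : ℂ) ^ ((q1 : ℂ) + p1 - j) *
          ((x 1 : ℝ) : ℂ) ^ ((q1 : ℂ) + q2 - j + p2 - p0) * ((1 - x 1 : ℝ) : ℂ) ^ j * ((x 2 : ℝ) : ℂ) ^ (q1 : ℂ) *
          ((1 - x 2 : ℝ) : ℂ) ^ (p1 : ℂ) / ((1 - (1 - x 0 * x 1) * x 2 : ℝ) : ℂ) ^ ((p2 : ℂ) + 1)) := by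
    have h := rv_phi_cpow ((p2 : ℂ)) ((q1 : ℂ) + q2 - j) ((q1 : ℂ) + q2 - j + p2 - p0) (j) ((q1 : ℂ)) ((q2 : ℂ)) ((p2 : ℂ) + q2 - p1 + 1)
      (by simp; linarith) (by simp; linarith) (by simp; linarith) (by simp; linarith) I4
      (I5.congr_fun (fun x _ => rv_pt_congr (by ring) (by ring) (by ring) (by ring) (by ring) (by ring) (by ring))
        (RhinViolaGenerators.measurableSet_cube 3))
    rw [show ((p2 : ℂ) + ((q1 : ℂ) + q2 - j) + 2 - ((p2 : ℂ) + q2 - p1 + 1) : ℂ) = (p1 : ℂ) + q1 - j + 1 by ring] at h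
    refine h.trans ?_
    congr 1
    exact rv_T_congr (by ring) (by ring) (by ring) (by ring) (by ring) (by ring) (by ring)
  -- ϑ, ϑ
  have S6 : (∫ x in (univ.pi fun _ : Fin 3 => Ioo (0:ℝ) 1), ((x 0 : ℝ) : ℂ) ^ ((p2 : ℂ) + q2 - p1) * ((1 - x 0 : ℝ) : ℂ) ^ ((q1 : ℂ) + p1 - j) *
          ((x 1 : ℝ) : ℂ) ^ ((q1 : ℂ) + q2 - j + p2 - p0) * ((1 - x 1 : ℝ) : ℂ) ^ j * ((x 2 : ℝ) : ℂ) ^ (q1 : ℂ) *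
          ((1 - x 2 : ℝ) : ℂ) ^ (p1 : ℂ) / ((1 - (1 - x 0 * x 1) * x 2 : ℝ) : ℂ) ^ ((p2 : ℂ) + 1)) =
      (∫ x in (univ.pi fun _ : Fin 3 => Ioo (0:ℝ) 1), ((x 0 : ℝ) : ℂ) ^ j * ((1 - x 0 : ℝ) : ℂ) ^ ((q1 : ℂ) + q2 - j + p2 - p0) *
          ((x 1 : ℝ) : ℂ) ^ (q1 : ℂ) * ((1 - x 1 : ℝ) : ℂ) ^ (q2 : ℂ) * ((x 2 : ℝ) : ℂ) ^ ((p2 : ℂ) + q2 - p1) *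
          ((1 - x 2 : ℝ) : ℂ) ^ ((q1 : ℂ) + q2 - j + p1 - p0) / ((1 - (1 - x 0 * x 1) * x 2 : ℝ) : ℂ) ^ ((q1 : ℂ) + q2 - p0 + 1)) :=
    (rv_theta_invariance_cpow ((p2 : ℂ) + q2 - p1) ((q1 : ℂ) + p1 - j) ((q1 : ℂ) + q2 - j + p2 - p0) (j) ((q1 : ℂ)) ((p1 : ℂ)) ((p2 : ℂ) + 1) (by ring)).trans
      (rv_T_congr (by ring) (by ring) (by ring) (by ring) (by ring) (by ring) (by ring))
  have S7 : (∫ x in (univ.pi fun _ : Fin 3 => Ioo (0:ℝ) 1), ((x 0 : ℝ) : ℂ) ^ j * ((1 - x 0 : ℝ) : ℂ) ^ ((q1 : ℂ) + q2 - j + p2 - p0) *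
          ((x 1 : ℝ) : ℂ) ^ (q1 : ℂ) * ((1 - x 1 : ℝ) : ℂ) ^ (q2 : ℂ) * ((x 2 : ℝ) : ℂ) ^ ((p2 : ℂ) + q2 - p1) *
          ((1 - x 2 : ℝ) : ℂ) ^ ((q1 : ℂ) + q2 - j + p1 - p0) / ((1 - (1 - x 0 * x 1) * x 2 : ℝ) : ℂ) ^ ((q1 : ℂ) + q2 - p0 + 1)) =
      (∫ x in (univ.pi fun _ : Fin 3 => Ioo (0:ℝ) 1), ((x 0 : ℝ) : ℂ) ^ (q2 : ℂ) * ((1 - x 0 : ℝ) : ℂ) ^ (q1 : ℂ) *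
          ((x 1 : ℝ) : ℂ) ^ ((p2 : ℂ) + q2 - p1) * ((1 - x 1 : ℝ) : ℂ) ^ (p1 : ℂ) * ((x 2 : ℝ) : ℂ) ^ j *
          ((1 - x 2 : ℝ) : ℂ) ^ ((p1 : ℂ) + q1 - j) / ((1 - (1 - x 0 * x 1) * x 2 : ℝ) : ℂ) ^ ((p0 : ℂ) + 1)) :=
    (rv_theta_invariance_cpow (j) ((q1 : ℂ) + q2 - j + p2 - p0) ((q1 : ℂ)) ((q2 : ℂ)) ((p2 : ℂ) + q2 - p1) ((q1 : ℂ) + q2 - j + p1 - p0) ((q1 : ℂ) + q2 - p0 + 1) (by ring)).trans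
      (rv_T_congr (by ring) (by ring) (by ring) (by ring) (by ring) (by ring) (by ring))
  rw [S1, S2, S3, S4, ← S7, ← S6]
  exact S5

/-- **Brown–Zudilin's `h`-step as a conjugate of TWO Euler steps** (`h = σ·φ·ϑϑϑϑ·φ·ϑϑϑ`): for naturals `p₀ ≤ p₂+q₂`,
`p₀ ≤ q₁+q₂`, `p₁, q₁, p₂, q₂` and complex `j` with `−1 < Re j < min(q₁+q₂+1, p₁+q₁+1)`, `p₀ + Re j < min(p₁,p₂)+q₁+q₂+1`,
and `Q = q₁+q₂−j`:
`Γ(q₁+q₂−p₀+1)Γ(p₁+q₁−j+1)Γ(p₂+q₂−p₀+1)Γ(p₀+1)·T(p₁,q₁,p₂,q₂;j,Q;p₀+1) = Γ(q₁+1)Γ(Q+p₁−p₀+1)Γ(q₂+1)Γ(p₂+1)·T(p₁,q₁+q₂−p₀,p₂+q₂−p₀,p₀;j,Q;q₂+1)`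
— WITHOUT `p₀ ≤ p₁+q₁`. [BrownZudilin2022, Sect. 7 (`h`); RV §4] -/
theorem rv_conj_h (p0 p1 q1 p2 q2 : ℕ) (hq : p0 ≤ q1 + q2) (hk : p0 ≤ p2 + q2) (j : ℂ) (hj : -1 < j.re)
    (hjQ : j.re < q1 + q2 + 1) (hjc : j.re < p1 + q1 + 1) (hA : (p0 : ℝ) + j.re < p1 + q1 + q2 + 1)
    (hB : (p0 : ℝ) + j.re < p2 + q1 + q2 + 1) :
    Complex.Gamma ((q1 : ℂ) + q2 - p0 + 1) * Complex.Gamma ((p1 : ℂ) + q1 - j + 1) *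
      Complex.Gamma ((p2 : ℂ) + q2 - p0 + 1) * Complex.Gamma ((p0 : ℂ) + 1) *
        (∫ x in (univ.pi fun _ : Fin 3 => Ioo (0:ℝ) 1), ((x 0 : ℝ) : ℂ) ^ (p1 : ℂ) * ((1 - x 0 : ℝ) : ℂ) ^ (q1 : ℂ) *
          ((x 1 : ℝ) : ℂ) ^ (p2 : ℂ) * ((1 - x 1 : ℝ) : ℂ) ^ (q2 : ℂ) * ((x 2 : ℝ) : ℂ) ^ j *
          ((1 - x 2 : ℝ) : ℂ) ^ ((q1 : ℂ) + q2 - j) / ((1 - (1 - x 0 * x 1) * x 2 : ℝ) : ℂ) ^ ((p0 : ℂ) + 1)) =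
      Complex.Gamma ((q1 : ℂ) + 1) * Complex.Gamma ((q1 : ℂ) + q2 - j + p1 - p0 + 1) * Complex.Gamma ((q2 : ℂ) + 1) *
      Complex.Gamma ((p2 : ℂ) + 1) *
        (∫ x in (univ.pi fun _ : Fin 3 => Ioo (0:ℝ) 1), ((x 0 : ℝ) : ℂ) ^ (p1 : ℂ) * ((1 - x 0 : ℝ) : ℂ) ^ ((q1 : ℂ) + q2 - p0) *
          ((x 1 : ℝ) : ℂ) ^ ((p2 : ℂ) + q2 - p0) * ((1 - x 1 : ℝ) : ℂ) ^ (p0 : ℂ) * ((x 2 : ℝ) : ℂ) ^ j *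
          ((1 - x 2 : ℝ) : ℂ) ^ ((q1 : ℂ) + q2 - j) / ((1 - (1 - x 0 * x 1) * x 2 : ℝ) : ℂ) ^ ((q2 : ℂ) + 1)) := by
  have hq' : (p0 : ℝ) ≤ q1 + q2 := by exact_mod_cast hq
  have hk' : (p0 : ℝ) ≤ p2 + q2 := by exact_mod_cast hk
  have n0 := p0.cast_nonneg (α := ℝ); have n1 := p1.cast_nonneg (α := ℝ); have m1 := q1.cast_nonneg (α := ℝ)
  have n2 := p2.cast_nonneg (α := ℝ); have m2 := q2.cast_nonneg (α := ℝ)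
  -- absolute convergence around the two Euler steps
  have I1 := rv_integrableOn_cpow ((p2 : ℂ)) ((q2 : ℂ)) ((p1 : ℂ)) ((q1 : ℂ)) (j) ((q1 : ℂ) + q2 - j) ((p0 : ℂ) + 1)
    (by simp; linarith) (by simp; linarith) (by simp; linarith) (by simp; linarith) hj
    (by simp; linarith) (by simp; linarith) (by simp; linarith)
  have I2 := rv_integrableOn_cpow ((p0 : ℂ)) ((p2 : ℂ) + q2 - p0) ((p1 : ℂ)) ((q1 : ℂ)) (j) ((q1 : ℂ) + q2 - j + p2 - p0) ((p2 : ℂ) + 1)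
    (by simp; linarith) (by simp; linarith) (by simp; linarith) (by simp; linarith) hj
    (by simp; linarith) (by simp; linarith) (by simp; linarith)
  have I6 := rv_integrableOn_cpow ((q1 : ℂ) + q2 - j + p1 - p0) ((q1 : ℂ)) ((q1 : ℂ) + q2 - j) ((p2 : ℂ) + q2 - p0) ((q1 : ℂ) + q2 - j + p2 - p0) (j) ((q1 : ℂ) + q2 - p0 + 1)
    (by simp; linarith) (by simp; linarith) (by simp; linarith) (by simp; linarith) (by simp; linarith)
    hj (by simp; linarith) (by simp; linarith)
  have I7 := rv_integrableOn_cpow ((q1 : ℂ) + q2 - p0) ((p1 : ℂ) + q1 - j) ((q1 : ℂ) + q2 - j) ((p2 : ℂ) + q2 - p0) ((q1 : ℂ) + q2 - j + p2 - p0) ((p1 : ℂ)) ((q1 : ℂ) + q2 - j + p1 - p0 + 1)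
    (by simp; linarith) (by simp; linarith) (by simp; linarith) (by simp; linarith) (by simp; linarith)
    (by simp; linarith) (by simp; linarith) (by simp; linarith)
  -- σ
  have S1 : (∫ x in (univ.pi fun _ : Fin 3 => Ioo (0:ℝ) 1), ((x 0 : ℝ) : ℂ) ^ (p1 : ℂ) * ((1 - x 0 : ℝ) : ℂ) ^ (q1 : ℂ) *
          ((x 1 : ℝ) : ℂ) ^ (p2 : ℂ) * ((1 - x 1 : ℝ) : ℂ) ^ (q2 : ℂ) * ((x 2 : ℝ) : ℂ) ^ j *
          ((1 - x 2 : ℝ) : ℂ) ^ ((q1 : ℂ) + q2 - j) / ((1 - (1 - x 0 * x 1) * x 2 : ℝ) : ℂ) ^ ((p0 : ℂ) + 1)) =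
      (∫ x in (univ.pi fun _ : Fin 3 => Ioo (0:ℝ) 1), ((x 0 : ℝ) : ℂ) ^ (p2 : ℂ) * ((1 - x 0 : ℝ) : ℂ) ^ (q2 : ℂ) *
          ((x 1 : ℝ) : ℂ) ^ (p1 : ℂ) * ((1 - x 1 : ℝ) : ℂ) ^ (q1 : ℂ) * ((x 2 : ℝ) : ℂ) ^ j *
          ((1 - x 2 : ℝ) : ℂ) ^ ((q1 : ℂ) + q2 - j) / ((1 - (1 - x 0 * x 1) * x 2 : ℝ) : ℂ) ^ ((p0 : ℂ) + 1)) :=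
    rv_sigma_cpow _ _ _ _ _ _ _
  -- φ in `x` (link exponent `p₀+1 ↦ p₂+1`)
  have S2 : Complex.Gamma ((p0 : ℂ) + 1) * Complex.Gamma ((p2 : ℂ) + q2 - p0 + 1) *
      (∫ x in (univ.pi fun _ : Fin 3 => Ioo (0:ℝ) 1), ((x 0 : ℝ) : ℂ) ^ (p2 : ℂ) * ((1 - x 0 : ℝ) : ℂ) ^ (q2 : ℂ) *
          ((x 1 : ℝ) : ℂ) ^ (p1 : ℂ) * ((1 - x 1 : ℝ) : ℂ) ^ (q1 : ℂ) * ((x 2 : ℝ) : ℂ) ^ j *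
          ((1 - x 2 : ℝ) : ℂ) ^ ((q1 : ℂ) + q2 - j) / ((1 - (1 - x 0 * x 1) * x 2 : ℝ) : ℂ) ^ ((p0 : ℂ) + 1)) =
      Complex.Gamma ((p2 : ℂ) + 1) * Complex.Gamma ((q2 : ℂ) + 1) *
      (∫ x in (univ.pi fun _ : Fin 3 => Ioo (0:ℝ) 1), ((x 0 : ℝ) : ℂ) ^ (p0 : ℂ) * ((1 - x 0 : ℝ) : ℂ) ^ ((p2 : ℂ) + q2 - p0) *
          ((x 1 : ℝ) : ℂ) ^ (p1 : ℂ) * ((1 - x 1 : ℝ) : ℂ) ^ (q1 : ℂ) * ((x 2 : ℝ) : ℂ) ^ j *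
          ((1 - x 2 : ℝ) : ℂ) ^ ((q1 : ℂ) + q2 - j + p2 - p0) / ((1 - (1 - x 0 * x 1) * x 2 : ℝ) : ℂ) ^ ((p2 : ℂ) + 1)) := by
    have h := rv_phi_cpow ((p2 : ℂ)) ((q2 : ℂ)) ((p1 : ℂ)) ((q1 : ℂ)) (j) ((q1 : ℂ) + q2 - j) ((p0 : ℂ) + 1)
      (by simp; linarith) (by simp; linarith) (by simp; linarith) (by simp; linarith) I1
      (I2.congr_fun (fun x _ => rv_pt_congr (by ring) (by ring) (by ring) (by ring) (by ring) (by ring) (by ring))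
        (RhinViolaGenerators.measurableSet_cube 3))
    rw [show ((p2 : ℂ) + (q2 : ℂ) + 2 - ((p0 : ℂ) + 1) : ℂ) = (p2 : ℂ) + q2 - p0 + 1 by ring] at h
    refine h.trans ?_
    congr 1
    exact rv_T_congr (by ring) (by ring) (by ring) (by ring) (by ring) (by ring) (by ring)
  -- ϑ⁴
  have S3 : (∫ x in (univ.pi fun _ : Fin 3 => Ioo (0:ℝ) 1), ((x 0 : ℝ) : ℂ) ^ (p0 : ℂ) * ((1 - x 0 : ℝ) : ℂ) ^ ((p2 : ℂ) + q2 - p0) *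
          ((x 1 : ℝ) : ℂ) ^ (p1 : ℂ) * ((1 - x 1 : ℝ) : ℂ) ^ (q1 : ℂ) * ((x 2 : ℝ) : ℂ) ^ j *
          ((1 - x 2 : ℝ) : ℂ) ^ ((q1 : ℂ) + q2 - j + p2 - p0) / ((1 - (1 - x 0 * x 1) * x 2 : ℝ) : ℂ) ^ ((p2 : ℂ) + 1)) =
      (∫ x in (univ.pi fun _ : Fin 3 => Ioo (0:ℝ) 1), ((x 0 : ℝ) : ℂ) ^ (q1 : ℂ) * ((1 - x 0 : ℝ) : ℂ) ^ (p1 : ℂ) *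
          ((x 1 : ℝ) : ℂ) ^ j * ((1 - x 1 : ℝ) : ℂ) ^ ((q1 : ℂ) + q2 - j) * ((x 2 : ℝ) : ℂ) ^ (p0 : ℂ) *
          ((1 - x 2 : ℝ) : ℂ) ^ ((q1 : ℂ) + q2 - j + p1 - p0) / ((1 - (1 - x 0 * x 1) * x 2 : ℝ) : ℂ) ^ ((p1 : ℂ) + q1 - p2 + 1)) :=
    (rv_theta_invariance_cpow ((p0 : ℂ)) ((p2 : ℂ) + q2 - p0) ((p1 : ℂ)) ((q1 : ℂ)) (j) ((q1 : ℂ) + q2 - j + p2 - p0) ((p2 : ℂ) + 1) (by ring)).trans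
      (rv_T_congr (by ring) (by ring) (by ring) (by ring) (by ring) (by ring) (by ring))
  have S4 : (∫ x in (univ.pi fun _ : Fin 3 => Ioo (0:ℝ) 1), ((x 0 : ℝ) : ℂ) ^ (q1 : ℂ) * ((1 - x 0 : ℝ) : ℂ) ^ (p1 : ℂ) *
          ((x 1 : ℝ) : ℂ) ^ j * ((1 - x 1 : ℝ) : ℂ) ^ ((q1 : ℂ) + q2 - j) * ((x 2 : ℝ) : ℂ) ^ (p0 : ℂ) *
          ((1 - x 2 : ℝ) : ℂ) ^ ((q1 : ℂ) + q2 - j + p1 - p0) / ((1 - (1 - x 0 * x 1) * x 2 : ℝ) : ℂ) ^ ((p1 : ℂ) + q1 - p2 + 1)) =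
      (∫ x in (univ.pi fun _ : Fin 3 => Ioo (0:ℝ) 1), ((x 0 : ℝ) : ℂ) ^ ((q1 : ℂ) + q2 - j) * ((1 - x 0 : ℝ) : ℂ) ^ j *
          ((x 1 : ℝ) : ℂ) ^ (p0 : ℂ) * ((1 - x 1 : ℝ) : ℂ) ^ ((q1 : ℂ) + q2 - j + p2 - p0) * ((x 2 : ℝ) : ℂ) ^ (q1 : ℂ) *
          ((1 - x 2 : ℝ) : ℂ) ^ ((p2 : ℂ) + q2 - p0) / ((1 - (1 - x 0 * x 1) * x 2 : ℝ) : ℂ) ^ ((p2 : ℂ) + q2 - p1 + 1)) :=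
    (rv_theta_invariance_cpow ((q1 : ℂ)) ((p1 : ℂ)) (j) ((q1 : ℂ) + q2 - j) ((p0 : ℂ)) ((q1 : ℂ) + q2 - j + p1 - p0) ((p1 : ℂ) + q1 - p2 + 1) (by ring)).trans
      (rv_T_congr (by ring) (by ring) (by ring) (by ring) (by ring) (by ring) (by ring))
  have S5 : (∫ x in (univ.pi fun _ : Fin 3 => Ioo (0:ℝ) 1), ((x 0 : ℝ) : ℂ) ^ ((q1 : ℂ) + q2 - j) * ((1 - x 0 : ℝ) : ℂ) ^ j *
          ((x 1 : ℝ) : ℂ) ^ (p0 : ℂ) * ((1 - x 1 : ℝ) : ℂ) ^ ((q1 : ℂ) + q2 - j + p2 - p0) * ((x 2 : ℝ) : ℂ) ^ (q1 : ℂ) *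
          ((1 - x 2 : ℝ) : ℂ) ^ ((p2 : ℂ) + q2 - p0) / ((1 - (1 - x 0 * x 1) * x 2 : ℝ) : ℂ) ^ ((p2 : ℂ) + q2 - p1 + 1)) =
      (∫ x in (univ.pi fun _ : Fin 3 => Ioo (0:ℝ) 1), ((x 0 : ℝ) : ℂ) ^ ((q1 : ℂ) + q2 - j + p2 - p0) * ((1 - x 0 : ℝ) : ℂ) ^ (p0 : ℂ) *
          ((x 1 : ℝ) : ℂ) ^ (q1 : ℂ) * ((1 - x 1 : ℝ) : ℂ) ^ ((q1 : ℂ) + q2 - j + p1 - p0) * ((x 2 : ℝ) : ℂ) ^ ((q1 : ℂ) + q2 - j) *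
          ((1 - x 2 : ℝ) : ℂ) ^ (p1 : ℂ) / ((1 - (1 - x 0 * x 1) * x 2 : ℝ) : ℂ) ^ ((p1 : ℂ) + q1 - j + 1)) :=
    (rv_theta_invariance_cpow ((q1 : ℂ) + q2 - j) (j) ((p0 : ℂ)) ((q1 : ℂ) + q2 - j + p2 - p0) ((q1 : ℂ)) ((p2 : ℂ) + q2 - p0) ((p2 : ℂ) + q2 - p1 + 1) (by ring)).trans
      (rv_T_congr (by ring) (by ring) (by ring) (by ring) (by ring) (by ring) (by ring))
  have S6 : (∫ x in (univ.pi fun _ : Fin 3 => Ioo (0:ℝ) 1), ((x 0 : ℝ) : ℂ) ^ ((q1 : ℂ) + q2 - j + p2 - p0) * ((1 - x 0 : ℝ) : ℂ) ^ (p0 : ℂ) *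
          ((x 1 : ℝ) : ℂ) ^ (q1 : ℂ) * ((1 - x 1 : ℝ) : ℂ) ^ ((q1 : ℂ) + q2 - j + p1 - p0) * ((x 2 : ℝ) : ℂ) ^ ((q1 : ℂ) + q2 - j) *
          ((1 - x 2 : ℝ) : ℂ) ^ (p1 : ℂ) / ((1 - (1 - x 0 * x 1) * x 2 : ℝ) : ℂ) ^ ((p1 : ℂ) + q1 - j + 1)) =
      (∫ x in (univ.pi fun _ : Fin 3 => Ioo (0:ℝ) 1), ((x 0 : ℝ) : ℂ) ^ ((q1 : ℂ) + q2 - j + p1 - p0) * ((1 - x 0 : ℝ) : ℂ) ^ (q1 : ℂ) *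
          ((x 1 : ℝ) : ℂ) ^ ((q1 : ℂ) + q2 - j) * ((1 - x 1 : ℝ) : ℂ) ^ ((p2 : ℂ) + q2 - p0) * ((x 2 : ℝ) : ℂ) ^ ((q1 : ℂ) + q2 - j + p2 - p0) *
          ((1 - x 2 : ℝ) : ℂ) ^ j / ((1 - (1 - x 0 * x 1) * x 2 : ℝ) : ℂ) ^ ((q1 : ℂ) + q2 - p0 + 1)) :=
    (rv_theta_invariance_cpow ((q1 : ℂ) + q2 - j + p2 - p0) ((p0 : ℂ)) ((q1 : ℂ)) ((q1 : ℂ) + q2 - j + p1 - p0) ((q1 : ℂ) + q2 - j) ((p1 : ℂ)) ((p1 : ℂ) + q1 - j + 1) (by ring)).trans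
      (rv_T_congr (by ring) (by ring) (by ring) (by ring) (by ring) (by ring) (by ring))
  -- φ in `x` (link exponent `q₁+q₂−p₀+1 ↦ Q+p₁−p₀+1`)
  have S7 : Complex.Gamma ((q1 : ℂ) + q2 - p0 + 1) * Complex.Gamma ((p1 : ℂ) + q1 - j + 1) *
      (∫ x in (univ.pi fun _ : Fin 3 => Ioo (0:ℝ) 1), ((x 0 : ℝ) : ℂ) ^ ((q1 : ℂ) + q2 - j + p1 - p0) * ((1 - x 0 : ℝ) : ℂ) ^ (q1 : ℂ) *
          ((x 1 : ℝ) : ℂ) ^ ((q1 : ℂ) + q2 - j) * ((1 - x 1 : ℝ) : ℂ) ^ ((p2 : ℂ) + q2 - p0) * ((x 2 : ℝ) : ℂ) ^ ((q1 : ℂ) + q2 - j + p2 - p0) *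
          ((1 - x 2 : ℝ) : ℂ) ^ j / ((1 - (1 - x 0 * x 1) * x 2 : ℝ) : ℂ) ^ ((q1 : ℂ) + q2 - p0 + 1)) =
      Complex.Gamma ((q1 : ℂ) + q2 - j + p1 - p0 + 1) * Complex.Gamma ((q1 : ℂ) + 1) *
      (∫ x in (univ.pi fun _ : Fin 3 => Ioo (0:ℝ) 1), ((x 0 : ℝ) : ℂ) ^ ((q1 : ℂ) + q2 - p0) * ((1 - x 0 : ℝ) : ℂ) ^ ((p1 : ℂ) + q1 - j) *
          ((x 1 : ℝ) : ℂ) ^ ((q1 : ℂ) + q2 - j) * ((1 - x 1 : ℝ) : ℂ) ^ ((p2 : ℂ) + q2 - p0) * ((x 2 : ℝ) : ℂ) ^ ((q1 : ℂ) + q2 - j + p2 - p0) *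
          ((1 - x 2 : ℝ) : ℂ) ^ (p1 : ℂ) / ((1 - (1 - x 0 * x 1) * x 2 : ℝ) : ℂ) ^ ((q1 : ℂ) + q2 - j + p1 - p0 + 1)) := by
    have h := rv_phi_cpow ((q1 : ℂ) + q2 - j + p1 - p0) ((q1 : ℂ)) ((q1 : ℂ) + q2 - j) ((p2 : ℂ) + q2 - p0) ((q1 : ℂ) + q2 - j + p2 - p0) (j) ((q1 : ℂ) + q2 - p0 + 1)
      (by simp; linarith) (by simp; linarith) (by simp; linarith) (by simp; linarith) I6
      (I7.congr_fun (fun x _ => rv_pt_congr (by ring) (by ring) (by ring) (by ring) (by ring) (by ring) (by ring))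
        (RhinViolaGenerators.measurableSet_cube 3))
    rw [show (((q1 : ℂ) + q2 - j + p1 - p0) + (q1 : ℂ) + 2 - ((q1 : ℂ) + q2 - p0 + 1) : ℂ) = (p1 : ℂ) + q1 - j + 1 by ring] at h
    refine h.trans ?_
    congr 1
    exact rv_T_congr (by ring) (by ring) (by ring) (by ring) (by ring) (by ring) (by ring)
  -- ϑ³
  have S8 : (∫ x in (univ.pi fun _ : Fin 3 => Ioo (0:ℝ) 1), ((x 0 : ℝ) : ℂ) ^ ((q1 : ℂ) + q2 - p0) * ((1 - x 0 : ℝ) : ℂ) ^ ((p1 : ℂ) + q1 - j) *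
          ((x 1 : ℝ) : ℂ) ^ ((q1 : ℂ) + q2 - j) * ((1 - x 1 : ℝ) : ℂ) ^ ((p2 : ℂ) + q2 - p0) * ((x 2 : ℝ) : ℂ) ^ ((q1 : ℂ) + q2 - j + p2 - p0) *
          ((1 - x 2 : ℝ) : ℂ) ^ (p1 : ℂ) / ((1 - (1 - x 0 * x 1) * x 2 : ℝ) : ℂ) ^ ((q1 : ℂ) + q2 - j + p1 - p0 + 1)) =
      (∫ x in (univ.pi fun _ : Fin 3 => Ioo (0:ℝ) 1), ((x 0 : ℝ) : ℂ) ^ ((p2 : ℂ) + q2 - p0) * ((1 - x 0 : ℝ) : ℂ) ^ ((q1 : ℂ) + q2 - j) *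
          ((x 1 : ℝ) : ℂ) ^ ((q1 : ℂ) + q2 - j + p2 - p0) * ((1 - x 1 : ℝ) : ℂ) ^ j * ((x 2 : ℝ) : ℂ) ^ ((q1 : ℂ) + q2 - p0) *
          ((1 - x 2 : ℝ) : ℂ) ^ (p0 : ℂ) / ((1 - (1 - x 0 * x 1) * x 2 : ℝ) : ℂ) ^ ((p2 : ℂ) + q2 - p1 + 1)) :=
    (rv_theta_invariance_cpow ((q1 : ℂ) + q2 - p0) ((p1 : ℂ) + q1 - j) ((q1 : ℂ) + q2 - j) ((p2 : ℂ) + q2 - p0) ((q1 : ℂ) + q2 - j + p2 - p0) ((p1 : ℂ)) ((q1 : ℂ) + q2 - j + p1 - p0 + 1) (by ring)).trans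
      (rv_T_congr (by ring) (by ring) (by ring) (by ring) (by ring) (by ring) (by ring))
  have S9 : (∫ x in (univ.pi fun _ : Fin 3 => Ioo (0:ℝ) 1), ((x 0 : ℝ) : ℂ) ^ ((p2 : ℂ) + q2 - p0) * ((1 - x 0 : ℝ) : ℂ) ^ ((q1 : ℂ) + q2 - j) *
          ((x 1 : ℝ) : ℂ) ^ ((q1 : ℂ) + q2 - j + p2 - p0) * ((1 - x 1 : ℝ) : ℂ) ^ j * ((x 2 : ℝ) : ℂ) ^ ((q1 : ℂ) + q2 - p0) *
          ((1 - x 2 : ℝ) : ℂ) ^ (p0 : ℂ) / ((1 - (1 - x 0 * x 1) * x 2 : ℝ) : ℂ) ^ ((p2 : ℂ) + q2 - p1 + 1)) =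
      (∫ x in (univ.pi fun _ : Fin 3 => Ioo (0:ℝ) 1), ((x 0 : ℝ) : ℂ) ^ j * ((1 - x 0 : ℝ) : ℂ) ^ ((q1 : ℂ) + q2 - j + p2 - p0) *
          ((x 1 : ℝ) : ℂ) ^ ((q1 : ℂ) + q2 - p0) * ((1 - x 1 : ℝ) : ℂ) ^ (p1 : ℂ) * ((x 2 : ℝ) : ℂ) ^ ((p2 : ℂ) + q2 - p0) *
          ((1 - x 2 : ℝ) : ℂ) ^ ((p1 : ℂ) + q1 - j) / ((1 - (1 - x 0 * x 1) * x 2 : ℝ) : ℂ) ^ ((p1 : ℂ) + q1 - p0 + 1)) :=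
    (rv_theta_invariance_cpow ((p2 : ℂ) + q2 - p0) ((q1 : ℂ) + q2 - j) ((q1 : ℂ) + q2 - j + p2 - p0) (j) ((q1 : ℂ) + q2 - p0) ((p0 : ℂ)) ((p2 : ℂ) + q2 - p1 + 1) (by ring)).trans
      (rv_T_congr (by ring) (by ring) (by ring) (by ring) (by ring) (by ring) (by ring))
  have S10 : (∫ x in (univ.pi fun _ : Fin 3 => Ioo (0:ℝ) 1), ((x 0 : ℝ) : ℂ) ^ j * ((1 - x 0 : ℝ) : ℂ) ^ ((q1 : ℂ) + q2 - j + p2 - p0) *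
          ((x 1 : ℝ) : ℂ) ^ ((q1 : ℂ) + q2 - p0) * ((1 - x 1 : ℝ) : ℂ) ^ (p1 : ℂ) * ((x 2 : ℝ) : ℂ) ^ ((p2 : ℂ) + q2 - p0) *
          ((1 - x 2 : ℝ) : ℂ) ^ ((p1 : ℂ) + q1 - j) / ((1 - (1 - x 0 * x 1) * x 2 : ℝ) : ℂ) ^ ((p1 : ℂ) + q1 - p0 + 1)) =
      (∫ x in (univ.pi fun _ : Fin 3 => Ioo (0:ℝ) 1), ((x 0 : ℝ) : ℂ) ^ (p1 : ℂ) * ((1 - x 0 : ℝ) : ℂ) ^ ((q1 : ℂ) + q2 - p0) *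
          ((x 1 : ℝ) : ℂ) ^ ((p2 : ℂ) + q2 - p0) * ((1 - x 1 : ℝ) : ℂ) ^ (p0 : ℂ) * ((x 2 : ℝ) : ℂ) ^ j *
          ((1 - x 2 : ℝ) : ℂ) ^ ((q1 : ℂ) + q2 - j) / ((1 - (1 - x 0 * x 1) * x 2 : ℝ) : ℂ) ^ ((q2 : ℂ) + 1)) :=
    (rv_theta_invariance_cpow (j) ((q1 : ℂ) + q2 - j + p2 - p0) ((q1 : ℂ) + q2 - p0) ((p1 : ℂ)) ((p2 : ℂ) + q2 - p0) ((p1 : ℂ) + q1 - j) ((p1 : ℂ) + q1 - p0 + 1) (by ring)).trans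
      (rv_T_congr (by ring) (by ring) (by ring) (by ring) (by ring) (by ring) (by ring))
  -- non-vanishing Gamma values and assembly of the two constants
  have G0 : Complex.Gamma ((p0 : ℂ) + 1) ≠ 0 := Complex.Gamma_ne_zero_of_re_pos (by simp; linarith)
  have Gk : Complex.Gamma ((p2 : ℂ) + q2 - p0 + 1) ≠ 0 := Complex.Gamma_ne_zero_of_re_pos (by simp; linarith)
  have GQ : Complex.Gamma ((q1 : ℂ) + q2 - p0 + 1) ≠ 0 := Complex.Gamma_ne_zero_of_re_pos (by simp; linarith)
  have Gj' : Complex.Gamma ((p1 : ℂ) + q1 - j + 1) ≠ 0 := Complex.Gamma_ne_zero_of_re_pos (by simp; linarith)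
  rw [S3, S4, S5, S6] at S2
  rw [S1, ← S10, ← S9, ← S8]
  generalize (∫ x in (univ.pi fun _ : Fin 3 => Ioo (0:ℝ) 1), ((x 0 : ℝ) : ℂ) ^ (p2 : ℂ) * ((1 - x 0 : ℝ) : ℂ) ^ (q2 : ℂ) *
          ((x 1 : ℝ) : ℂ) ^ (p1 : ℂ) * ((1 - x 1 : ℝ) : ℂ) ^ (q1 : ℂ) * ((x 2 : ℝ) : ℂ) ^ j *
          ((1 - x 2 : ℝ) : ℂ) ^ ((q1 : ℂ) + q2 - j) / ((1 - (1 - x 0 * x 1) * x 2 : ℝ) : ℂ) ^ ((p0 : ℂ) + 1)) = A at S2 ⊢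
  generalize (∫ x in (univ.pi fun _ : Fin 3 => Ioo (0:ℝ) 1), ((x 0 : ℝ) : ℂ) ^ ((q1 : ℂ) + q2 - j + p1 - p0) * ((1 - x 0 : ℝ) : ℂ) ^ (q1 : ℂ) *
          ((x 1 : ℝ) : ℂ) ^ ((q1 : ℂ) + q2 - j) * ((1 - x 1 : ℝ) : ℂ) ^ ((p2 : ℂ) + q2 - p0) * ((x 2 : ℝ) : ℂ) ^ ((q1 : ℂ) + q2 - j + p2 - p0) *
          ((1 - x 2 : ℝ) : ℂ) ^ j / ((1 - (1 - x 0 * x 1) * x 2 : ℝ) : ℂ) ^ ((q1 : ℂ) + q2 - p0 + 1)) = B at S2 S7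
  generalize (∫ x in (univ.pi fun _ : Fin 3 => Ioo (0:ℝ) 1), ((x 0 : ℝ) : ℂ) ^ ((q1 : ℂ) + q2 - p0) * ((1 - x 0 : ℝ) : ℂ) ^ ((p1 : ℂ) + q1 - j) *
          ((x 1 : ℝ) : ℂ) ^ ((q1 : ℂ) + q2 - j) * ((1 - x 1 : ℝ) : ℂ) ^ ((p2 : ℂ) + q2 - p0) * ((x 2 : ℝ) : ℂ) ^ ((q1 : ℂ) + q2 - j + p2 - p0) *
          ((1 - x 2 : ℝ) : ℂ) ^ (p1 : ℂ) / ((1 - (1 - x 0 * x 1) * x 2 : ℝ) : ℂ) ^ ((q1 : ℂ) + q2 - j + p1 - p0 + 1)) = C at S7 ⊢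
  have hA' : A = Complex.Gamma ((p2 : ℂ) + 1) * Complex.Gamma ((q2 : ℂ) + 1) /
      (Complex.Gamma ((p0 : ℂ) + 1) * Complex.Gamma ((p2 : ℂ) + q2 - p0 + 1)) * B := by
    rw [div_mul_eq_mul_div, eq_div_iff (mul_ne_zero G0 Gk)]; linear_combination S2
  have hB' : B = Complex.Gamma ((q1 : ℂ) + q2 - j + p1 - p0 + 1) * Complex.Gamma ((q1 : ℂ) + 1) /
      (Complex.Gamma ((q1 : ℂ) + q2 - p0 + 1) * Complex.Gamma ((p1 : ℂ) + q1 - j + 1)) * C := by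
    rw [div_mul_eq_mul_div, eq_div_iff (mul_ne_zero GQ Gj')]; linear_combination S7
  rw [hA', hB']
  field_simp

end Summit.KontsevichZagierPeriods.Zeta5Search.RhinViolaConjugation

end
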